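import Summits.Ventures.PercRepro.Night2FatXStructure

/-!
# night-2: the faces inside a target containing the off-point (fat case)

With at most one fat closure `clF B₀` and the fat split `G ∖ clF B₀ = {w₀, x}` of a lossy basis pair, the
four-point thin members `B′ ⊆ T` of a target `T ∋ x` fall into two classes:

* the FAT faces `B′ ⊆ clF B₀`: their closure is `clF B₀` (`clF_eq_of_thin_subset_clF`), so their weight in
  `faceSum T` is exactly `|(T ∖ K) ∖ clF B₀| = 2` (`card_sdiff_clF_eq_two_of_fat_off_mem`), `phiFace ≤ 61/360`;
* every other face misses at least three points of `G` (`three_le_card_sdiff_of_clF_ne`) and has `phiFace ≤ 1/9`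
  (`phiFace_le_of_three_le`) and weight `≤ |T ∖ K| − 4` (`card_sdiff_clF_le_card_sub_four`).

`faceSum_le_of_fat_off_mem` records the resulting split bound
`faceSum T ≤ 2 · Σ_{fat faces ⊆ T} phiFace + (1/9) · (|T ∖ K| − 4) · #(other faces ⊆ T)`.
Paper `proofs/NIGHT-2-g32.md` §2.
-/

namespace PercRepro.Shadow

open PercRepro.ThmH PercRepro.PerFlat

variable {α : Type*} [DecidableEq α] {M : Matroid α} [M.Finite] {G : Finset α}

/-- With at most one fat closure, a thin member whose closure is not the fat closure `clF B₀` misses at least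
three points of `G`. -/
theorem three_le_card_sdiff_of_clF_ne (hfat : (fatClosures M 5 G 2).card ≤ 1) {B₀ : Finset α}
    (hB₀ : B₀ ∈ thinMembers M 5 G) (hm₀ : (G \ clF M B₀).card ≤ 2) {B : Finset α}
    (hB : B ∈ thinMembers M 5 G) (hne : clF M B ≠ clF M B₀) : 3 ≤ (G \ clF M B).card := by
  by_contra h
  rw [not_le] at h
  have h1 : clF M B ∈ fatClosures M 5 G 2 := by
    unfold fatClosures
    rw [Finset.mem_image]
    exact ⟨B, Finset.mem_filter.2 ⟨hB, by omega⟩, rfl⟩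
  have h2 : clF M B₀ ∈ fatClosures M 5 G 2 := by
    unfold fatClosures
    rw [Finset.mem_image]
    exact ⟨B₀, Finset.mem_filter.2 ⟨hB₀, hm₀⟩, rfl⟩
  have h3 := Finset.card_le_card (Finset.insert_subset h1 (Finset.singleton_subset_iff.2 h2))
  rw [Finset.card_pair hne] at h3
  omega

/-- `phiFace ≤ 1/9 = 40/360` at a thin member missing at least three points of `G` (`req ≤ 7/30`). -/
theorem phiFace_le_of_three_le (hG : G ∈ flatsQ M (5 + 1)) (hd : (gr M \ G).card = 2) {B : Finset α}
    (hB : B ∈ thinMembers M 5 G) (h3 : 3 ≤ (G \ clF M B).card) : phiFace M B ≤ 1 / 9 := by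
  unfold phiFace
  apply max_le (by norm_num)
  rw [req_eq_of_thin hG hB, hd]
  have h3' : (3 : ℚ) ≤ ((G \ clF M B).card : ℚ) := by exact_mod_cast h3
  have hreq : phiQ 5 / (((G \ clF M B).card : ℚ) + ((2 : ℕ) : ℚ)) ≤ 7 / 30 := by
    unfold phiQ
    rw [div_le_iff₀ (by push_cast; linarith)]
    push_cast
    linarith
  linarith

/-- A thin member inside the closure of another thin member has the same closure (both of rank `5`). -/
theorem clF_eq_of_thin_subset_clF (hG : G ∈ flatsQ M (5 + 1)) {B₀ B : Finset α}
    (hB₀ : B₀ ∈ thinMembers M 5 G) (hB : B ∈ thinMembers M 5 G) (hsub : B ⊆ clF M B₀) :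
    clF M B = clF M B₀ := by
  apply clF_eq_clF_of_subset_clF_of_rkN_le ((subset_G_of_mem_thinMembers hB₀).trans (mem_flatsQ.1 hG).1) hsub
  rw [rkN_eq_five_of_mem_thinMembers hB₀, rkN_eq_five_of_mem_thinMembers hB]

/-- **A fat face of a target containing the off-point weighs exactly `2`**: with the fat split
`G ∖ clF B₀ = {w₀, x}` and `w₀, x ∈ T ⊆ G`, a thin member `B′ ⊆ clF B₀` has `(T ∖ K) ∖ clF B′ = {w₀, x}`. -/
theorem card_sdiff_clF_eq_two_of_fat_off_mem (hG : G ∈ flatsQ M (5 + 1)) (hd : (gr M \ G).card = 2)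
    {B₀ : Finset α} (hB₀ : B₀ ∈ thinMembers M 5 G) {w₀ x : α} (hD : G \ clF M B₀ = {w₀, x}) (hne : w₀ ≠ x)
    {T : Finset α} (hTG : T ⊆ G) (hw₀ : w₀ ∈ T) (hx : x ∈ T) {B' : Finset α}
    (hB' : B' ∈ thinMembers M 5 G) (hsub : B' ⊆ clF M B₀) :
    ((T \ coloops M G) \ clF M B').card = 2 := by
  have hd' : (gr M \ G).card ≤ 5 := by omega
  rw [clF_eq_of_thin_subset_clF hG hB₀ hB' hsub]
  have hKcl : coloops M G ⊆ clF M B₀ :=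
    (coloops_subset_of_mem_thinMembers hG hd' hB₀).trans
      (subset_clF_of_subset_gr ((subset_G_of_mem_thinMembers hB₀).trans (mem_flatsQ.1 hG).1))
  have hw₀cl : w₀ ∉ clF M B₀ := by
    have : w₀ ∈ G \ clF M B₀ := by
      rw [hD]
      exact Finset.mem_insert_self _ _
    exact (Finset.mem_sdiff.1 this).2
  have hxcl : x ∉ clF M B₀ := by
    have : x ∈ G \ clF M B₀ := by
      rw [hD]
      exact Finset.mem_insert_of_mem (Finset.mem_singleton_self _)
    exact (Finset.mem_sdiff.1 this).2
  have heq : (T \ coloops M G) \ clF M B₀ = {w₀, x} := by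
    ext e
    rw [Finset.mem_sdiff, Finset.mem_sdiff]
    constructor
    · rintro ⟨⟨heT, -⟩, hecl⟩
      have : e ∈ G \ clF M B₀ := Finset.mem_sdiff.2 ⟨hTG heT, hecl⟩
      rw [hD] at this
      exact this
    · intro he
      rw [Finset.mem_insert, Finset.mem_singleton] at he
      rcases he with rfl | rfl
      · exact ⟨⟨hw₀, fun h => hw₀cl (hKcl h)⟩, hw₀cl⟩
      · exact ⟨⟨hx, fun h => hxcl (hKcl h)⟩, hxcl⟩
  rw [heq, Finset.card_pair hne]

/-- The weight of a four-point thin member inside `T` is at most `|T ∖ K| − 4`. -/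
theorem card_sdiff_clF_le_card_sub_four (hG : G ∈ flatsQ M (5 + 1)) (hd : (gr M \ G).card = 2)
    (hk : kColoops M G = 1) {T : Finset α} {B' : Finset α} (hB' : B' ∈ thinMembers M 5 G)
    (hnP : ¬ bigP M G B') (hB'T : B' ⊆ T) :
    ((T \ coloops M G) \ clF M B').card ≤ (T \ coloops M G).card - 4 := by
  have hB4 := card_sdiff_eq_four_of_not_bigP hG hd hk hB' hnP
  have hB'g : B' ⊆ gr M := (subset_G_of_mem_thinMembers hB').trans (mem_flatsQ.1 hG).1
  have hsub : (T \ coloops M G) \ clF M B' ⊆ (T \ coloops M G) \ (B' \ coloops M G) := by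
    intro e he
    rw [Finset.mem_sdiff] at he ⊢
    refine ⟨he.1, fun h => he.2 (subset_clF_of_subset_gr hB'g (Finset.mem_sdiff.1 h).1)⟩
  have hsub2 : B' \ coloops M G ⊆ T \ coloops M G := Finset.sdiff_subset_sdiff hB'T (Finset.Subset.refl _)
  have := Finset.card_le_card hsub
  rw [Finset.card_sdiff_of_subset hsub2, hB4] at this
  exact this

/-- **The split face-sum bound at a target containing the off-point**: the fat faces (inside `clF B₀`) weigh
exactly `2`, every other face has `phiFace ≤ 1/9` and weight `≤ |T ∖ K| − 4`. -/
theorem faceSum_le_of_fat_off_mem (hG : G ∈ flatsQ M (5 + 1)) (hd : (gr M \ G).card = 2)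
    (hk : kColoops M G = 1) (hfat : (fatClosures M 5 G 2).card ≤ 1) {B₀ : Finset α}
    (hB₀ : B₀ ∈ thinMembers M 5 G) {w₀ x : α} (hD : G \ clF M B₀ = {w₀, x}) (hne : w₀ ≠ x)
    {T : Finset α} (hTG : T ⊆ G) (hw₀ : w₀ ∈ T) (hx : x ∈ T) :
    faceSum M G T ≤
      2 * ∑ B' ∈ (thinMembers M 5 G).filter (fun B' => (¬ bigP M G B' ∧ B' ⊆ T) ∧ B' ⊆ clF M B₀), phiFace M B'
      + (1 / 9) * (((T \ coloops M G).card - 4 : ℕ) : ℚ) *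
        (((thinMembers M 5 G).filter (fun B' => (¬ bigP M G B' ∧ B' ⊆ T) ∧ ¬ B' ⊆ clF M B₀)).card : ℚ) := by
  have hm₀ : (G \ clF M B₀).card ≤ 2 := by rw [hD, Finset.card_pair hne]
  unfold faceSum
  rw [← Finset.sum_filter_add_sum_filter_not ((thinMembers M 5 G).filter (fun B' => ¬ bigP M G B' ∧ B' ⊆ T))
    (fun B' => B' ⊆ clF M B₀), Finset.filter_filter, Finset.filter_filter]
  apply add_le_add
  · rw [Finset.mul_sum]
    apply Finset.sum_le_sum
    intro B' hB'
    rw [Finset.mem_filter] at hB'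
    rw [card_sdiff_clF_eq_two_of_fat_off_mem hG hd hB₀ hD hne hTG hw₀ hx hB'.1 hB'.2.2]
    push_cast
    linarith
  · calc ∑ B' ∈ (thinMembers M 5 G).filter (fun B' => (¬ bigP M G B' ∧ B' ⊆ T) ∧ ¬ B' ⊆ clF M B₀),
          phiFace M B' * (((T \ coloops M G) \ clF M B').card : ℚ)
        ≤ ∑ _B' ∈ (thinMembers M 5 G).filter (fun B' => (¬ bigP M G B' ∧ B' ⊆ T) ∧ ¬ B' ⊆ clF M B₀),
          (1 / 9 : ℚ) * (((T \ coloops M G).card - 4 : ℕ) : ℚ) := by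
          apply Finset.sum_le_sum
          intro B' hB'
          rw [Finset.mem_filter] at hB'
          have hne' : clF M B' ≠ clF M B₀ := fun h => hB'.2.2 (h ▸ subset_clF_of_subset_gr
            ((subset_G_of_mem_thinMembers hB'.1).trans (mem_flatsQ.1 hG).1))
          have h3 := three_le_card_sdiff_of_clF_ne hfat hB₀ hm₀ hB'.1 hne'
          have hphi := phiFace_le_of_three_le hG hd hB'.1 h3
          have hw := card_sdiff_clF_le_card_sub_four hG hd hk hB'.1 hB'.2.1.1 hB'.2.1.2
          have hw' : (((T \ coloops M G) \ clF M B').card : ℚ) ≤ (((T \ coloops M G).card - 4 : ℕ) : ℚ) := by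
            exact_mod_cast hw
          exact mul_le_mul hphi hw' (Nat.cast_nonneg _) (by norm_num)
      _ = (1 / 9 : ℚ) * (((T \ coloops M G).card - 4 : ℕ) : ℚ) *
          (((thinMembers M 5 G).filter (fun B' => (¬ bigP M G B' ∧ B' ⊆ T) ∧ ¬ B' ⊆ clF M B₀)).card : ℚ) := by
          rw [Finset.sum_const, nsmul_eq_mul]
          ring

end PercRepro.Shadow
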